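import Literature.Probability.Percolation.GladkovZiminCopositive
import Literature.Probability.Percolation.GladkovZiminKernelMeasure
import HarnessLib

/-!
# The copositive (complete-positivity) Gladkov–Zimin kernel inequality for bond percolation laws

Topic `Literature/Probability/Percolation`.  Transfer of the finitary copositive two-copy kernel inequality
`DecisionTree.kernel_classMass_le_of_pairCopositive` (`GladkovZiminCopositive.lean`: Gladkov–Zimin, *On
Harris–Kleitman type inequalities*, draft 2024, Thm. 2.3 upgraded by Thm. 4.3 / Prop. 4.4 [GladkovZimin2024HK])
to the bond-percolation measure `prodBernoulli w`, exactly as `GladkovZiminKernelMeasure.lean` does for the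
cover-supermodular (Thm. 2.3) case:

* **`prodBernoulli_kernel_labelClass_le_of_pairCopositive`** — for every labelling `lab` of configurations by a
  preorder, monotone under adding open edges, every finite `t` containing all labels, and every kernel `A` that
  is PAIR-COPOSITIVE along the cube of edges (`DecisionTree.PairCopositive (Sym2 V) A`; e.g. by
  `pairCopositive_of_gram`: pair kernel = Gram + entrywise nonnegative, the certificates a semidefinite
  programme produces), `Σ_{a,b ∈ t} A a b · μ(lab = a) μ(lab = b) ≤ Σ_{a ∈ t} A a a · μ(lab = a)`.

This is the row lemma for "DNN / copositive GZ rows" of the percolation certificate searches of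
`Summits/CriticalPhenomena/PercolationContinuityZ3` (crux `NoHeavyLowerTail`; memo
run/shared/lean/prim/prim-ineq-gen-2/COPOSITIVE-GZ.md).

## References
* N. Gladkov, A. Zimin, *On Harris–Kleitman type inequalities*, unpublished draft, September 2024, Thms. 2.3, 4.3,
  Prop. 4.4. [GladkovZimin2024HK]
-/

noncomputable section

namespace Literature.Probability.Percolation

open MeasureTheory Literature.Probability.LatticeModels DecisionTree
open scoped Classical

/-- **Copositive Gladkov–Zimin kernel inequality for `prodBernoulli`.**  Let `lab` label bond configurations of
a finite vertex type by a preorder, monotonically under adding open edges, let `t` contain every value of `lab`,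
and let `A` be pair-copositive along the cube of edges (`PairCopositive (Sym2 V) A`, e.g. from a PSD + nonnegative
split of its pair kernel via `pairCopositive_of_gram`, or from the pointwise condition of Thm. 2.3 via
`pairCopositive_of_cross`).  Then `Σ_{a,b ∈ t} A a b · μ(lab = a) μ(lab = b) ≤ Σ_{a ∈ t} A a a · μ(lab = a)`,
`μ = prodBernoulli w`. [cite: GladkovZimin2024HK, Thm. 2.3, Thm. 4.3, Prop. 4.4] -/
theorem prodBernoulli_kernel_labelClass_le_of_pairCopositive {V : Type*} [Fintype V]
    (w : Sym2 V → unitInterval) {κ : Type*} [Preorder κ] (lab : BondConfig V → κ)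
    (hlab : ∀ ⦃ω ω' : BondConfig V⦄, ω ⊆ ω' → lab ω ≤ lab ω') (t : Finset κ) (ht : ∀ ω, lab ω ∈ t)
    (A : κ → κ → ℝ) (hA : PairCopositive (Sym2 V) A) :
    ∑ a ∈ t, ∑ b ∈ t, A a b *
        ((prodBernoulli w).real {ω | lab ω = a} * (prodBernoulli w).real {ω | lab ω = b}) ≤
      ∑ a ∈ t, A a a * (prodBernoulli w).real {ω | lab ω = a} := by
  simp only [prodBernoulli_real_labelClass_eq_classMass]
  exact kernel_classMass_le_of_pairCopositive Finset.univ (fun e => (w e).2.1) (fun e => (w e).2.2)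
    (fun S : Finset (Sym2 V) => lab ↑S) (fun S T hST => hlab (Finset.coe_subset.2 hST)) t
    (fun S _ => ht _) A hA

end Literature.Probability.Percolation

end
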